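import Summits.ResolutionOfSingularities.ResolutionOfSingularities.Theorems.FrobeniusClosingPatchingRelPerfectDepthMultiHostFormatSncPointwise
import Summits.ResolutionOfSingularities.ResolutionOfSingularities.Theorems.FrobeniusClosingPatchingRelPerfectDepthSncLocusOpen
import HarnessLib

/-!
# Crux `PatchingRelPerfect` (stmt-ResolutionOfSingularities-16161), chain W5.2 — F7(β) d = 2 (β-AX) A1: FORMAT-SNC END ON AN OPEN from
# POINTWISE simple normal crossings on a SET (the composed U-form wrapper of res-L1-w52-plan-1 RULING G11-17 (2)(i) over
# res-D-pv-046's openness lemma)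

[OURS · L1 W5.2 · F7(β) (β-AX) A1 · RULING G11-17 (2)(i) «sibling `…FormatSncOpen.lean` = … the U-form wrapper importing pv-046΄s lemma when it
lands»; inputs: `MultiHostState.exists_isFormatSncOn_of_forall_sncWithAt` (p550670) and `DepthSNC.exists_isOpen_forall_sncWithAt'` (res-D-pv-046,
p550469).]  Replaces the role of NO printed item; NOT a statement of the manuscript under review; fact-free.  AI-written; AI review is weaker
than expert review.  No definitions.

* **`MultiHostState.exists_isFormatSncOn_of_forall_sncWithAt_mem`** — on a quasi-excellent Noetherian `X`: if the family `𝓒 ++ S.𝓔` has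
  simple normal crossings (pointwise on `X`) at every point of a SET `Z` (e.g. the residual cosupport), the host lists live on `𝓒 ++ S.𝓔`,
  and the hosts factor on an open `U₀ ⊇ Z`, then `S.IsFormatSncOn U 𝓒 𝓗` on some open `U` with `Z ⊆ U ≤ U₀` — the currency T3 must output
  (targets `PhaseCTermination₂`: `Sf.IsFormatSncOn U′ 𝓒′ 𝓗′ ∧ cosupp Sf.K ⊆ U′`).

## References
* E. Bierstone, D. Grigoriev, P. Milman, J. Włodarczyk (2011), Def. 3.1.1, Def. 3.1.3, Thm. 8.0.5. [BierstoneGrigorievMilmanWlodarczyk2011]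
* H. Matsumura, *Commutative Ring Theory* (1986), §32 p. 260 (J-2: the regular loci that make the snc locus open). [Matsumura1987]
-/

-- `Summit.<Summit>.<Sub>.Theorems` with `Sub = Summit` (single-conjunct summit, D-0017)
set_option linter.dupNamespace false

noncomputable section

open CategoryTheory AlgebraicGeometry TopologicalSpace
open Literature.AlgebraicGeometry.Resolution
open Scheme.IdealSheafData

namespace Summit.ResolutionOfSingularities.ResolutionOfSingularities.Theorems.DepthMultiHost.MultiHostState

universe u

variable {X : Scheme.{u}} [IsNoetherian X]

/-- **Format-snc END on an open from pointwise snc on a set** (RULING G11-17 (2)(i), composed): `X` quasi-excellent Noetherian; `𝓒 ++ S.𝓔`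
snc (pointwise) at every point of `Z`; host lists on `𝓒 ++ S.𝓔`; hosts factorised on the open `U₀ ⊇ Z` ⇒ `∃ U, Z ⊆ U ≤ U₀ ∧
S.IsFormatSncOn U 𝓒 𝓗` (res-D-pv-046's `DepthSNC.exists_isOpen_forall_sncWithAt'` + `exists_isFormatSncOn_of_forall_sncWithAt`, p550670).
[cite: BierstoneGrigorievMilmanWlodarczyk2011, Def. 3.1.3, Thm. 8.0.5] [cite: Matsumura1987, §32 p. 260] -/
theorem exists_isFormatSncOn_of_forall_sncWithAt_mem (hX : Scheme.IsQuasiExcellent X) (S : MultiHostState X) {Z : Set X}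
    {U₀ : X.Opens} (hZU₀ : Z ⊆ (U₀ : Set X)) (𝓒 : List X.IdealSheafData) (𝓗 : Fin S.n → List (X.IdealSheafData × ℕ))
    (hb : ∀ i, boundaryOf (𝓗 i) = 𝓒 ++ S.𝓔) (hsnc : ∀ x ∈ Z, DepthSNC.SNCWithAt (𝓒 ++ S.𝓔) ⊤ x)
    (hhost : ∀ i, (S.host i).comap U₀.ι = (monomialIdeal (𝓗 i)).comap U₀.ι) :
    ∃ U : X.Opens, Z ⊆ (U : Set X) ∧ U ≤ U₀ ∧ S.IsFormatSncOn U 𝓒 𝓗 := by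
  obtain ⟨U, hZU, hU⟩ := DepthSNC.exists_isOpen_forall_sncWithAt' hX (𝓒 ++ S.𝓔) hsnc
  exact S.exists_isFormatSncOn_of_forall_sncWithAt hZU hZU₀ 𝓒 𝓗 hb hU hhost

end Summit.ResolutionOfSingularities.ResolutionOfSingularities.Theorems.DepthMultiHost.MultiHostState

end
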